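import Mathlib.NumberTheory.Padics.RingHoms
import Literature.NumberTheory.FaltingsSerre.ParamodularCertificate
import Literature.NumberTheory.Automorphic.Paramodular.Paramodularity
import Literature.NumberTheory.GaloisRepresentations.FramedRepBaseChange
import Literature.NumberTheory.GaloisRepresentations.ResidualPairIntegrality
import HarnessLib

/-!
# The Faltings–Serre method after Brumer–Pacetti–Poor–Tornaría–Voight–Yuen, V:
# from a 2-adic certificate to "`A` is paramodular of level `N` away from `N`"

[BPPTVY] = A. Brumer, A. Pacetti, C. Poor, G. Tornaría, J. Voight, D. S. Yuen, *On the paramodularity of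
typical abelian surfaces*, Algebra & Number Theory **13**:5 (2019) 1145–1195 [cite: BrumerEtAl2019]
(PRINTED numbering and pages).

This file is the ASSEMBLY STEP the certificate pipeline instantiates: it joins
* the certificate schema `Literature.NumberTheory.FaltingsSerre.Certificate S P J ν ρ₁ ρ₂` and its
  kernel-checked consequence `Certificate.hasFrobCharpolyAt_iff` (conjugate `2`-adic representations
  have the same Frobenius characteristic polynomials at EVERY place; from the cited criterion
  `traceEq_of_faltingsSerre_symplectic` = [BPPTVY, Thm 2.1.5 / Alg 2.4.1, pp. 1150, 1156–1157]
  and the tree's proved Carayol theorem = [BPPTVY, Thm 2.1.4]) — `ParamodularCertificate.lean`;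
* the tree's conclusion predicate `Literature.NumberTheory.Automorphic.Paramodular.IsParamodularAwayFrom
  A N f` ("`f ∈ S₂(K(N))`, `f ≢ 0`, and `L_p(A,T) = Q_p(f,T) ∈ ℚ[T]` for every prime `p ∤ N`",
  [BPPTVY, Thm 7.1.3 p. 1187 restricted to `p ∤ N`]) with its vocabulary
  `AbelianVariety.HasGoodEulerFactorAt` ((4.1.4)–(4.1.5) p. 1164), `AbelianVariety.IsFrameOfTateRep`
  ((4.1.3) p. 1163), `HasSpinorEulerFactorAt` ((4.2.18) p. 1168) — `Automorphic/Paramodular/Paramodularity.lean`;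
* the tree's transport lemmas for framed representations under the change of coefficients
  `ℤ₂ ↪ ℚ₂` (`FramedRep.baseChange`, `FramedGaloisRep.isUnramifiedAt_baseChange_iff`,
  `FramedGaloisRep.hasFrobCharpolyAt_baseChange_iff`) and the PROVED uniqueness of Frobenius
  polynomials over a number field (`FramedGaloisRep.HasFrobCharpolyAt.unique`, which uses the proved
  existence of arithmetic Frobenius elements).

## The theorem (`isParamodularAwayFrom_of_certificate`) and the provenance of each binder
For `A : AbelianVariety ℚ`, `N ≥ 1`, `f : ℍ₂ → ℂ`, integer polynomials `LA p, Qf p ∈ ℤ[T]` (`p` prime):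
* `hFS : traceEq_of_faltingsSerre_symplectic` — the CITED criterion [BPPTVY, Thm 2.1.5] (named fact);
* `C : Certificate S P J ν ρ₁ ρ₂` — the COMPUTED certificate for two framed `ρ₁ ρ₂ : Gal_ℚ → GL₄(ℤ₂)`
  (Steps 1–5 of Alg 2.4.1: [BPPTVY, §§5–7]);
* `hframe : A.IsFrameOfTateRep 2 b (rationalize ρ₁)` — `ρ₁` IS `ρ_{A,2}`: the matrix form of the
  Galois action on the Tate module in a `ℤ₂`-basis `b` of `T₂A ⊂ V₂A` ((4.1.3) p. 1163);
* `hA : ∀ p ∤ N, A.HasGoodEulerFactorAt p (LA p)` — the CURVE SIDE: `p ∤ N` is good for `A` and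
  `L_p(A,T) = LA p` for every `ℓ ≠ p` ((4.1.4)–(4.1.5) p. 1164: `ℓ`-independence [SGA7] and point
  counts; "`N = cond(A)`" is not in the tree, so this is where the conductor enters);
* `hρ₂ : ∀ p ∤ 2N, ∀ v ∣ p, ρ₂.HasFrobCharpolyAt v (X⁴ (Qf p)(1/X))` — `ρ₂` IS an integral form of
  `ρ_{f,2}`: [BPPTVY, Thm 4.3.4 p. 1169 (Taylor, Laumon, Weissauer, Schmidt, Mok — DEPENDS ON
  ARTHUR'S CLASSIFICATION, see `Automorphic/Paramodular/GaloisRepresentation.lean` and the cell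
  pub-arthur) + Lemma 4.3.8(b) p. 1171 (Carayol descent to `GSp₄(ℚ₂)` for rational eigenvalues and
  absolutely irreducible `ρ̄`) + a stable lattice]; the tree's fact
  `BrumerEtAl2019.existsGaloisRep_weightTwo_primeLevel` delivers the `ℚ₂^al`-valued representation,
  and `hasFrobCharpolyAt_of_baseChange_padicAlgCl` below transports its Frobenius polynomials to a
  `ℤ₂`-form once one is exhibited;
* `hcusp`, `hne`, `hf : ∀ p ∤ N, HasSpinorEulerFactorAt 2 p f (Qf p)` — the FORM SIDE: `f ∈ S₂(K(N))`,
  `f ≢ 0`, and its Hecke eigenvalues / spinor Euler factors (4.2.18) ([BPPTVY, §6], computed);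
* `hLA0`, `hQf0` — constant coefficients `≠ 0` (they are `1`: `L_p, Q_p ∈ 1 + Tℤ[T]`), used only to
  invert `Polynomial.reverse`;
* `h2 : ¬ 2 ∣ N → LA 2 = Qf 2` — the prime `p = 2 = ℓ` is NOT decided by a `2`-adic comparison
  ([BPPTVY] obtain it from `ℓ`-independence; cell DIVERGENCE.md D-4): the pipeline discharges it by
  the explicit equality of the two computed polynomials `L_2(A,T)` and `Q_2(f,T)` (both sides are
  certificate data anyway; for `N` odd `2` is a good prime).
CONCLUSION: `IsParamodularAwayFrom A N f`.  Nothing here says "modular (GL₄)" (referee S3); the bad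
primes `p ∣ N` and "`N = cond(A)`" are outside the predicate, as its docstring says.

Also: `eulerFactor_eq_of_certificate` (the single-prime statement `LA = Qf` for `p ≠ 2`, no level in
sight), `integralForm_of_hasGoodEulerFactorAt` (curve side ⟹ `ρ₁` unramified at `v ∣ p` with Frobenius
polynomial `X⁴ LA(1/X)` over `ℤ₂`), and small lemmas on places of `ℚ` and `Polynomial.reverse`.

## References
* [BPPTVY] ANT 13:5 (2019): Thm 2.1.4/2.1.5 p. 1150, Alg 2.4.1 p. 1156, (4.1.3)–(4.1.5) pp. 1163–1164,
  (4.2.18) p. 1168, Thm 4.3.4 p. 1169, Lemma 4.3.6 p. 1170, Lemma 4.3.8 p. 1171, Thm 7.1.3 p. 1187.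
  [cite: BrumerEtAl2019]
-/

noncomputable section

namespace Literature.NumberTheory.FaltingsSerre

open Polynomial Field IsDedekindDomain
open Literature.NumberTheory.GaloisRepresentations Literature.NumberTheory.Automorphic.Paramodular
  Literature.NumberTheory.Automorphic Literature.AlgebraicGeometry.Motives
open scoped NumberField

/-! ## Places of `ℚ` above a rational prime -/

section Places

/-- Every rational prime `p` lies in some nonzero prime `v` of `𝓞 ℚ` (going up along `ℤ → 𝓞 ℚ`).
[folklore] -/
theorem exists_place_above {p : ℕ} (hp : p.Prime) :
    ∃ v : HeightOneSpectrum (𝓞 ℚ), ((p : ℕ) : 𝓞 ℚ) ∈ v.asIdeal := by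
  haveI : (Ideal.span {(p : ℤ)}).IsMaximal :=
    Ideal.IsPrime.isMaximal ((Ideal.span_singleton_prime (by exact_mod_cast hp.ne_zero)).2
      (Nat.prime_iff_prime_int.1 hp)) (by
        rw [Ne, Ideal.span_singleton_eq_bot]; exact_mod_cast hp.ne_zero)
  obtain ⟨Q, hQmax, hQ⟩ := Ideal.exists_ideal_over_maximal_of_isIntegral (S := 𝓞 ℚ)
    (Ideal.span {(p : ℤ)}) (by
      rw [(RingHom.injective_iff_ker_eq_bot _).1 (algebraMap ℤ (𝓞 ℚ)).injective_int]; exact bot_le)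
  have hpQ : ((p : ℕ) : 𝓞 ℚ) ∈ Q := by
    have : (p : ℤ) ∈ Q.comap (algebraMap ℤ (𝓞 ℚ)) := hQ ▸ Ideal.mem_span_singleton_self _
    simpa using this
  refine ⟨⟨Q, hQmax.isPrime, fun h => ?_⟩, hpQ⟩
  rw [h] at hpQ
  have : ((p : ℕ) : 𝓞 ℚ) = 0 := hpQ
  exact hp.ne_zero (by exact_mod_cast this)

/-- A prime `v` of `𝓞 ℚ` contains at most one rational prime (Bézout). [folklore] -/
theorem natCast_not_mem_of_ne {p q : ℕ} (hp : p.Prime) (hq : q.Prime) (hpq : p ≠ q)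
    {v : HeightOneSpectrum (𝓞 ℚ)} (hv : ((p : ℕ) : 𝓞 ℚ) ∈ v.asIdeal) :
    ((q : ℕ) : 𝓞 ℚ) ∉ v.asIdeal := by
  intro hq'
  have hcop : IsCoprime (p : ℤ) (q : ℤ) :=
    Nat.isCoprime_iff_coprime.mpr ((Nat.coprime_primes hp hq).mpr hpq)
  obtain ⟨a, b, hab⟩ := hcop
  apply v.isPrime.ne_top
  rw [Ideal.eq_top_iff_one]
  have h1 : (((a * p + b * q : ℤ)) : 𝓞 ℚ) = 1 := by rw [hab]; simp
  rw [← h1]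
  push_cast
  exact v.asIdeal.add_mem (v.asIdeal.mul_mem_left _ hv) (v.asIdeal.mul_mem_left _ hq')

/-- If `S` consists of places above primes dividing `M` and `p ∤ M` is prime, then no place above `p`
is in `S` (so for `S` = the places above `2N`, every `v ∣ p` with `p ∤ 2N` is "good"). [folklore] -/
theorem not_mem_of_liesOver {M : ℕ} {S : Set (HeightOneSpectrum (𝓞 ℚ))}
    (hS : ∀ v ∈ S, ∃ q : ℕ, q.Prime ∧ q ∣ M ∧ ((q : ℕ) : 𝓞 ℚ) ∈ v.asIdeal)
    {p : ℕ} (hp : p.Prime) (hpM : ¬ p ∣ M) {v : HeightOneSpectrum (𝓞 ℚ)}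
    (hv : ((p : ℕ) : 𝓞 ℚ) ∈ v.asIdeal) : v ∉ S := by
  intro hvS
  obtain ⟨q, hq, hqM, hqv⟩ := hS v hvS
  have hpq : p ≠ q := by rintro rfl; exact hpM hqM
  exact natCast_not_mem_of_ne hp hq hpq hv hqv

end Places

/-! ## `Polynomial.reverse` bookkeeping (`L_p(T)` versus `X⁴ L_p(1/X)`) -/

section Reverse

/-- `reverse` commutes with `map` along an injective ring homomorphism. [folklore] -/
theorem reverse_map_of_injective {R S : Type*} [Semiring R] [Semiring S] (φ : R →+* S)
    (hφ : Function.Injective φ) (p : R[X]) : (p.map φ).reverse = p.reverse.map φ := by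
  unfold Polynomial.reverse
  rw [natDegree_map_eq_of_injective hφ, reflect_map]

/-- `reverse` is injective on polynomials with nonzero constant coefficient (as are Euler factors
`L ∈ 1 + Tℤ[T]`). [folklore] -/
theorem eq_of_reverse_eq {R : Type*} [Semiring R] {p q : R[X]} (hp : p.coeff 0 ≠ 0)
    (hq : q.coeff 0 ≠ 0) (h : p.reverse = q.reverse) : p = q := by
  have hp0 : p.natTrailingDegree = 0 := natTrailingDegree_eq_zero_of_constantCoeff_ne_zero hp
  have hq0 : q.natTrailingDegree = 0 := natTrailingDegree_eq_zero_of_constantCoeff_ne_zero hq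
  have hdeg : p.natDegree = q.natDegree := by
    have h1 := reverse_natDegree p
    have h2 := reverse_natDegree q
    rw [hp0, Nat.sub_zero] at h1
    rw [hq0, Nat.sub_zero] at h2
    rw [← h1, ← h2, h]
  have key : reflect p.natDegree p.reverse = reflect q.natDegree q.reverse := by rw [h, hdeg]
  unfold Polynomial.reverse at key
  simpa only [reflect_reflect] using key

/-- Any two ring homomorphisms out of `ℤ` agree, in the form used below. [folklore] -/
theorem map_map_intCast {R S : Type*} [CommRing R] [CommRing S] (φ : ℤ →+* R) (ψ : R →+* S)
    (χ : ℤ →+* S) (p : ℤ[X]) : (p.map φ).map ψ = p.map χ := by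
  rw [Polynomial.map_map]
  congr 1
  exact RingHom.ext_int _ _

end Reverse

/-! ## `ℤ_ℓ`-forms and `ℚ_ℓ`-representations -/

section Rationalize

variable {K : Type} [Field K] {ℓ : ℕ} [Fact ℓ.Prime] {n : ℕ}

/-- The inclusion `ℤ_ℓ ↪ ℚ_ℓ` is continuous. [folklore] -/
theorem continuous_padicIntCoe : Continuous (PadicInt.Coe.ringHom (p := ℓ)) :=
  continuous_subtype_val

/-- The inclusion `ℤ_ℓ ↪ ℚ_ℓ` is injective. [folklore] -/
theorem injective_padicIntCoe : Function.Injective (PadicInt.Coe.ringHom (p := ℓ)) :=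
  Subtype.val_injective

/-- `ρ ⊗_{ℤ_ℓ} ℚ_ℓ : Gal(K̄/K) → GL_n(ℚ_ℓ)`, the rational representation of which the framed
`ρ : Gal(K̄/K) → GL_n(ℤ_ℓ)` is an integral form (a `ℤ_ℓ`-lattice basis of `T_ℓ A` is a `ℚ_ℓ`-basis of
`V_ℓ A`, [BPPTVY, (4.1.3) p. 1163]). [cite: BrumerEtAl2019, (4.1.3) p. 1163] -/
abbrev rationalize (ρ : FramedGaloisRep K ℤ_[ℓ] n) : FramedGaloisRep K ℚ_[ℓ] n :=
  ρ.baseChange PadicInt.Coe.ringHom continuous_padicIntCoe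

/-- Unramifiedness is the same for `ρ` and `ρ ⊗ ℚ_ℓ`. [folklore] -/
theorem isUnramifiedAt_rationalize_iff (ρ : FramedGaloisRep K ℤ_[ℓ] n)
    (v : HeightOneSpectrum (𝓞 K)) : (rationalize ρ).IsUnramifiedAt v ↔ ρ.IsUnramifiedAt v :=
  FramedGaloisRep.isUnramifiedAt_baseChange_iff _ _ injective_padicIntCoe v ρ

/-- Frobenius polynomials: `ρ ⊗ ℚ_ℓ` has `Q ⊗ ℚ_ℓ` at `v` iff `ρ` has `Q` at `v`. [folklore] -/
theorem hasFrobCharpolyAt_rationalize_iff (ρ : FramedGaloisRep K ℤ_[ℓ] n)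
    (v : HeightOneSpectrum (𝓞 K)) (Q : ℤ_[ℓ][X]) :
    (rationalize ρ).HasFrobCharpolyAt v (Q.map PadicInt.Coe.ringHom) ↔ ρ.HasFrobCharpolyAt v Q :=
  FramedGaloisRep.hasFrobCharpolyAt_baseChange_iff _ _ injective_padicIntCoe v ρ Q

/-- Transport of INTEGRAL Frobenius polynomials down any injective continuous change of
coefficients `φ : ℤ_ℓ → B` (e.g. `B = ℚ_ℓ^al`, for the representation of [BPPTVY, Thm 4.3.4] once a
`ℤ_ℓ`-form `ρ` with `ρ ⊗_φ B = ρ_{f,ℓ}` is exhibited): if `ρ ⊗_φ B` has Frobenius polynomial `χ ⊗ B`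
at `v` for an integer polynomial `χ`, then `ρ` has `χ ⊗ ℤ_ℓ` at `v`. [cite: BrumerEtAl2019, p. 1170 (stable lattice); Lemma 4.3.8(b) p. 1171] -/
theorem hasFrobCharpolyAt_of_baseChange {B : Type*} [CommRing B] [TopologicalSpace B]
    (φ : ℤ_[ℓ] →+* B) (hφ : Continuous φ) (hinj : Function.Injective φ)
    (ρ : FramedGaloisRep K ℤ_[ℓ] n) (v : HeightOneSpectrum (𝓞 K)) (χ : ℤ[X]) (ψ : ℤ →+* B)
    (h : FramedGaloisRep.HasFrobCharpolyAt v (χ.map ψ) (ρ.baseChange φ hφ)) :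
    ρ.HasFrobCharpolyAt v (χ.map (Int.castRingHom ℤ_[ℓ])) := by
  rw [← map_map_intCast (Int.castRingHom ℤ_[ℓ]) φ ψ χ] at h
  exact (FramedGaloisRep.hasFrobCharpolyAt_baseChange_iff φ hφ hinj v ρ _).mp h

end Rationalize

/-! ## The curve side at `ℓ = 2` -/

section CurveSide

variable {A : AbelianVariety ℚ}

/-- **Curve side ⟹ the `2`-adic integral form.**  If `LA = L_p(A,T)` is the good Euler factor of `A`
at `p ≠ 2` in the sense of `HasGoodEulerFactorAt` and `ρ₁ : Gal_ℚ → GL₄(ℤ₂)` is an integral form of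
`ρ_{A,2}` (`hframe`), then at every `v ∣ p`: `ρ₁` is unramified and its arithmetic Frobenius has
characteristic polynomial `X⁴ LA(1/X) ∈ ℤ₂[X]` [BPPTVY, (4.1.5) p. 1164: `det(1 - ρ_{A,ℓ}(Frob_p)T)
= L_p(A,T)`]. [cite: BrumerEtAl2019, (4.1.5) p. 1164] -/
theorem integralForm_of_hasGoodEulerFactorAt {p : ℕ} {LA : ℤ[X]}
    (hA : A.HasGoodEulerFactorAt p (LA.map (Int.castRingHom ℚ))) (hp2 : 2 ≠ p)
    {ρ₁ : FramedGaloisRep ℚ ℤ_[2] 4} {b : Module.Basis (Fin 4) ℚ_[2] (A.rationalTateModule 2)}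
    (hframe : A.IsFrameOfTateRep 2 b (rationalize ρ₁))
    {v : HeightOneSpectrum (𝓞 ℚ)} (hv : ((p : ℕ) : 𝓞 ℚ) ∈ v.asIdeal) :
    ρ₁.IsUnramifiedAt v ∧ ρ₁.HasFrobCharpolyAt v (LA.reverse.map (Int.castRingHom ℤ_[2])) := by
  have h := hA 2 hp2 b (rationalize ρ₁) hframe v hv
  refine ⟨(isUnramifiedAt_rationalize_iff ρ₁ v).mp h.1, ?_⟩
  have key : ((LA.map (Int.castRingHom ℚ)).reverse).map (algebraMap ℚ ℚ_[2]) =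
      ((LA.reverse).map (Int.castRingHom ℤ_[2])).map PadicInt.Coe.ringHom := by
    rw [reverse_map_of_injective _ (Int.castRingHom ℚ).injective_int,
      map_map_intCast (Int.castRingHom ℚ) (algebraMap ℚ ℚ_[2])
        ((PadicInt.Coe.ringHom (p := 2)).comp (Int.castRingHom ℤ_[2])),
      ← Polynomial.map_map]
  have h2 := h.2
  rw [key] at h2
  exact (hasFrobCharpolyAt_rationalize_iff ρ₁ v _).mp h2

end CurveSide

/-! ## The assembly -/

section Assembly

variable {S P : Set (HeightOneSpectrum (𝓞 ℚ))} {J : Matrix (Fin 4) (Fin 4) ℤ_[2]}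
  {ν : absoluteGaloisGroup ℚ → ℤ_[2]} {ρ₁ ρ₂ : FramedGaloisRep ℚ ℤ_[2] 4}
  {A : AbelianVariety ℚ} {b : Module.Basis (Fin 4) ℚ_[2] (A.rationalTateModule 2)}

/-- **One good prime.**  Under the cited criterion, a certificate for `(ρ₁, ρ₂)`, `ρ₁` an integral
form of `ρ_{A,2}`, the curve-side Euler factor `LA` of `A` at a prime `p ≠ 2` and an `f`-side
Frobenius polynomial `X⁴ Qf(1/X)` of `ρ₂` at some `v ∣ p`: `LA = Qf` in `ℤ[T]` — i.e.
`L_p(A,T) = Q_p(f,T)` [BPPTVY, Thm 7.1.3 p. 1187, for `p ∤ 2N`].  Proof: `ρ₂ = gρ₁g⁻¹`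
(`Certificate.hasFrobCharpolyAt_iff`), Frobenius polynomials at `v` are unique
(`FramedGaloisRep.HasFrobCharpolyAt.unique`, proved in the tree with the existence of Frobenius
elements), `ℤ → ℤ₂` is injective and `reverse` is injective on `1 + Tℤ[T]`.
[cite: BrumerEtAl2019, Thm 7.1.3 p. 1187] -/
theorem eulerFactor_eq_of_certificate (hFS : traceEq_of_faltingsSerre_symplectic)
    (C : Certificate S P J ν ρ₁ ρ₂) (hframe : A.IsFrameOfTateRep 2 b (rationalize ρ₁))
    {p : ℕ} (hp2 : p ≠ 2) {LA Qf : ℤ[X]} (hLA0 : LA.coeff 0 ≠ 0) (hQf0 : Qf.coeff 0 ≠ 0)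
    (hA : A.HasGoodEulerFactorAt p (LA.map (Int.castRingHom ℚ)))
    {v : HeightOneSpectrum (𝓞 ℚ)} (hv : ((p : ℕ) : 𝓞 ℚ) ∈ v.asIdeal)
    (hρ₂ : ρ₂.HasFrobCharpolyAt v (Qf.reverse.map (Int.castRingHom ℤ_[2]))) : LA = Qf := by
  have h₁ := (integralForm_of_hasGoodEulerFactorAt hA (Ne.symm hp2) hframe hv).2
  have h₂ := (C.hasFrobCharpolyAt_iff hFS v _).mpr hρ₂
  have h12 := FramedGaloisRep.HasFrobCharpolyAt.unique h₁ h₂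
  exact eq_of_reverse_eq hLA0 hQf0
    (Polynomial.map_injective _ (Int.castRingHom ℤ_[2]).injective_int h12)

/-- **`A` is paramodular of level `N` away from `N`, from a certificate** — the assembly the
certificate theorems `Summits/Langlands/…/<N>.lean` instantiate (see the module docstring for the
provenance of every binder: `hFS` cited [BPPTVY, Thm 2.1.5]; `C` computed; `hframe`, `hA` the curve
side (4.1.3)–(4.1.5); `hρ₂` the form side's Galois representation, Thm 4.3.4 (Arthur-dependent) +
Lemma 4.3.8(b); `hcusp`, `hne`, `hf` the form and its spinor Euler factors (4.2.18); `h2` the explicit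
check at `p = 2`).  Conclusion `IsParamodularAwayFrom A N f`: for every prime `p ∤ N`,
`L_p(A,T) = Q_p(f,T)`. [cite: BrumerEtAl2019, Thm 7.1.3 p. 1187; Thm 2.1.5 p. 1150; Thm 4.3.4 p. 1169] -/
theorem isParamodularAwayFrom_of_certificate (hFS : traceEq_of_faltingsSerre_symplectic)
    {N : ℕ} [NeZero N] {f : Matrix (Fin 2) (Fin 2) ℂ → ℂ}
    (C : Certificate S P J ν ρ₁ ρ₂) (hframe : A.IsFrameOfTateRep 2 b (rationalize ρ₁))
    (LA Qf : ℕ → ℤ[X]) (hLA0 : ∀ p, (LA p).coeff 0 ≠ 0) (hQf0 : ∀ p, (Qf p).coeff 0 ≠ 0)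
    (hA : ∀ p : ℕ, p.Prime → ¬ p ∣ N → A.HasGoodEulerFactorAt p ((LA p).map (Int.castRingHom ℚ)))
    (hρ₂ : ∀ p : ℕ, p.Prime → ¬ p ∣ N → p ≠ 2 →
      ∀ v : HeightOneSpectrum (𝓞 ℚ), ((p : ℕ) : 𝓞 ℚ) ∈ v.asIdeal →
        ρ₂.HasFrobCharpolyAt v ((Qf p).reverse.map (Int.castRingHom ℤ_[2])))
    (hcusp : IsParamodularCuspForm N 2 f) (hne : ∃ Z ∈ siegelUpperHalfSpace 2, f Z ≠ 0)
    (hf : ∀ p : ℕ, p.Prime → ¬ p ∣ N →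
      HasSpinorEulerFactorAt 2 p f ((Qf p).map (Int.castRingHom ℂ)))
    (h2 : ¬ 2 ∣ N → LA 2 = Qf 2) :
    IsParamodularAwayFrom A N f := by
  refine ⟨hcusp, hne, fun p hp hpN => ⟨(Qf p).map (Int.castRingHom ℚ), ?_, ?_⟩⟩
  · rw [map_map_intCast (Int.castRingHom ℚ) (algebraMap ℚ ℂ) (Int.castRingHom ℂ)]
    exact hf p hp hpN
  · have heq : LA p = Qf p := by
      by_cases hp2 : p = 2
      · subst hp2; exact h2 hpN
      · obtain ⟨v, hv⟩ := exists_place_above hp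
        exact eulerFactor_eq_of_certificate hFS C hframe hp2 (hLA0 p) (hQf0 p) (hA p hp hpN) hv
          (hρ₂ p hp hpN hp2 v hv)
    rw [← heq]
    exact hA p hp hpN

/-- The `L`-polynomial of the surface shape, `1 − aT + bT² − q a T³ + q² T⁴ ∈ ℤ[T]`
([BPPTVY, (4.1.5) p. 1164] for `L_p(A,T)`; (4.2.18) p. 1168 with `k = 2` for `Q_p(f,T)`); its
`X⁴ L(1/X)` is `eulerPolynomialOfSurface q a b` of `ParamodularCertificate.lean`.  This is the shape in
which the pipeline supplies `LA p` and `Qf p`. [cite: BrumerEtAl2019, (4.1.5) p. 1164 and (4.2.18) p. 1168] -/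
def lPolynomialOfSurface (q : ℕ) (a b : ℤ) : ℤ[X] :=
  1 - C a * X + C b * X ^ 2 - C ((q : ℤ) * a) * X ^ 3 + C ((q : ℤ) ^ 2) * X ^ 4

/-- `L ∈ 1 + Tℤ[T]`: the constant coefficient is `1` (so `hLA0` / `hQf0` of
`isParamodularAwayFrom_of_certificate` hold for surface-shaped data). [cite: BrumerEtAl2019, (4.1.5) p. 1164] -/
theorem lPolynomialOfSurface_coeff_zero (q : ℕ) (a b : ℤ) :
    (lPolynomialOfSurface q a b).coeff 0 = 1 := by
  simp [lPolynomialOfSurface]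

end Assembly

end Literature.NumberTheory.FaltingsSerre
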